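import Literature.Analysis.FluidPDE.LacunaryVolterraResolvent
import HarnessLib

/-!
# Cheskidov–Dai–Palasek 2025, §5.1 / Prop. 5.2: the smooth background enters the Volterra
# majorant of the linearisation as a constant — resolvent bound with background

Seventh sibling proof file (all results proved; no definitions, no named facts) of the barrier
entry `Literature/Barriers/NavierStokesRegularity/InstantaneousTypeIBlowup` (A. Cheskidov, M. Dai,
S. Palasek, arXiv:2511.09556 (2025), Thm. 1.1). The corrector `w` of §5 solves the perturbation
equation linearised around `U^{1/N₀} + v` (display before §5.1), `U` the classical background with
`sup_{n ≤ 10} ‖∇ⁿU‖_{L^∞_{t,x}} =: C_U < ∞` (§5, first display) and `v` the principal part; in the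
proof of Prop. 5.2 (the semigroup `S(t,t')` of the linearisation) the background enters only
through the factor `(C_U + ‖v(s)‖_{L^∞})` of the Duhamel kernel (terms `I₂`, `I₃`:
"`≲ ∫ (t-s)^{-1/2}(C_U + ‖v(s)‖_{L^∞})‖S(s,t')φ‖_{L^∞} ds`"). At the level of sup norms, the
tree renders the semigroup bound of the principal part ALONE as the boundedness of the
resolvent of the scalar Volterra operator `(K f)(t) = ∫₀ᵗ c(t-s)^{-1/2} ν(s) f(s) ds` on the
profile `t^{a-1/2}` (`Literature.Analysis.FluidPDE.LacunaryVolterra.tsum_iterate_volterraK_powProfile_le`,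
Coiculescu–Palasek 2025, Prop. 4.2), under the Koch–Tataru bound `√s ν(s) ≤ K₀` and the lacunary
bound `∫_{t₁}^{t₂}(ν² + s^{-1/2}ν) ≤ C(1 + η log(t₂/t₁))` on `ν(s) = ‖v(s)‖_∞` (Prop. 4.3, last
display, for CDP). This file proves that the majorant WITH background, `ν_U = C_U + ν`, inherits
both bounds on `(0, T]`, `T ≤ 1`, with constants `K₀ + C_U` and
`C_U' = C(1 + 2C_U) + C_U² + 2C_U` and the SAME slope `η` (`volterraData_const_add`), whence the
resolvent bound for the linearisation around `U^{1/N₀} + v`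
(`tsum_iterate_volterraK_powProfile_const_add_le`) — Prop. 5.2 in the form consumed by the
fixed point argument of Prop. 5.3 (`CP25Picard.exists_perturbation_fixedPoint`, hypothesis `hR`,
with `vt` the lift of `U(· + T_*) + v`).

## References

* A. Cheskidov, M. Dai, S. Palasek, arXiv:2511.09556 (2025): §5 (first display, `C_U`), the
  corrector equation before §5.1, Prop. 5.2 and its proof (terms `I₂`, `I₃`), Prop. 4.3 (last
  display). [`CheskidovDaiPalasek2025`]
* M. P. Coiculescu, S. Palasek, Invent. Math. 244 (2025), Prop. 4.2 (the tree's
  `LacunaryVolterraResolvent`). [`CoiculescuPalasek2025`]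
-/

noncomputable section

open MeasureTheory Set Filter intervalIntegral
open scoped ENNReal

namespace Literature.Barriers.NavierStokesRegularity

open Literature.Analysis.FluidPDE Literature.Analysis.FluidPDE.LacunaryVolterra

variable {ν : ℝ → ℝ} {K₀ C η T CU : ℝ}

/-- **The background as a constant in the majorant.** If `ν ≥ 0` is continuous on `(0, T]`,
`T ≤ 1`, with `√s ν(s) ≤ K₀` and `∫_{t₁}^{t₂}(ν² + s^{-1/2}ν) ds ≤ C(1 + η log(t₂/t₁))`
(`0 < t₁ ≤ t₂ ≤ T`), then `ν_U = C_U + ν` (`C_U ≥ 0`) satisfies `√s ν_U(s) ≤ K₀ + C_U` and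
`∫_{t₁}^{t₂}(ν_U² + s^{-1/2}ν_U) ds ≤ (C(1 + 2C_U) + C_U² + 2C_U)(1 + η log(t₂/t₁))`
(`∫ν ≤ ∫ s^{-1/2}ν` as `s ≤ 1`, `∫ C_U² ≤ C_U²`, `∫ C_U s^{-1/2} ≤ 2C_U`).
[cite: CheskidovDaiPalasek2025, proof of Prop. 5.2 (terms I₂, I₃)] -/
theorem volterraData_const_add (hT1 : T ≤ 1) (hη : 0 ≤ η) (hCU : 0 ≤ CU)
    (hνc : ContinuousOn ν (Ioc 0 T)) (hν0 : ∀ s ∈ Ioc 0 T, 0 ≤ ν s)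
    (h313a : ∀ s ∈ Ioc 0 T, Real.sqrt s * ν s ≤ K₀)
    (h313b : ∀ t₁ t₂ : ℝ, 0 < t₁ → t₁ ≤ t₂ → t₂ ≤ T →
      ∫ s in t₁..t₂, (ν s ^ 2 + s ^ (-(1 / 2 : ℝ)) * ν s) ≤ C * (1 + η * Real.log (t₂ / t₁))) :
    (∀ s ∈ Ioc 0 T, Real.sqrt s * (CU + ν s) ≤ K₀ + CU) ∧
    (∀ t₁ t₂ : ℝ, 0 < t₁ → t₁ ≤ t₂ → t₂ ≤ T →
      ∫ s in t₁..t₂, ((CU + ν s) ^ 2 + s ^ (-(1 / 2 : ℝ)) * (CU + ν s)) ≤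
        (C * (1 + 2 * CU) + CU ^ 2 + 2 * CU) * (1 + η * Real.log (t₂ / t₁))) := by
  refine ⟨fun s hs => ?_, fun t₁ t₂ ht₁ h12 h2T => ?_⟩
  · -- `√s ≤ 1` on `(0, T] ⊆ (0, 1]`
    have hs1 : Real.sqrt s ≤ 1 := Real.sqrt_le_one.2 (hs.2.trans hT1)  -- Real.sqrt_le_one : √x ≤ 1 ↔ x ≤ 1
    have h1 := h313a s hs
    have h2 : Real.sqrt s * CU ≤ 1 * CU := mul_le_mul_of_nonneg_right hs1 hCU
    calc Real.sqrt s * (CU + ν s) = Real.sqrt s * CU + Real.sqrt s * ν s := by ring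
      _ ≤ 1 * CU + K₀ := add_le_add h2 h1
      _ = K₀ + CU := by ring
  · set L : ℝ := Real.log (t₂ / t₁) with hL
    have hL0 : 0 ≤ L := Real.log_nonneg ((one_le_div ht₁).2 h12)
    have ht₂ : 0 < t₂ := ht₁.trans_le h12
    have hsub : Icc t₁ t₂ ⊆ Ioc 0 T := fun s hs => ⟨ht₁.trans_le hs.1, hs.2.trans h2T⟩
    -- interval integrability of the pieces
    have hνi : IntervalIntegrable ν volume t₁ t₂ := (hνc.mono hsub).intervalIntegrable_of_Icc h12
    have hri : IntervalIntegrable (fun s : ℝ => s ^ (-(1 / 2 : ℝ))) volume t₁ t₂ :=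
      (ContinuousOn.rpow_const continuousOn_id fun s hs =>
        Or.inl (ht₁.trans_le hs.1).ne').intervalIntegrable_of_Icc h12
    have hν2i : IntervalIntegrable (fun s => ν s ^ 2) volume t₁ t₂ :=
      ((hνc.pow 2).mono hsub).intervalIntegrable_of_Icc h12
    have hrνi : IntervalIntegrable (fun s : ℝ => s ^ (-(1 / 2 : ℝ)) * ν s) volume t₁ t₂ :=
      hri.mul_continuousOn (hνc.mono (by rw [uIcc_of_le h12]; exact hsub))
    have hAi : IntervalIntegrable (fun s : ℝ => ν s ^ 2 + s ^ (-(1 / 2 : ℝ)) * ν s) volume t₁ t₂ :=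
      hν2i.add hrνi
    have hBi : IntervalIntegrable
        (fun s : ℝ => 2 * CU * (s ^ (-(1 / 2 : ℝ)) * ν s) + CU ^ 2 + CU * s ^ (-(1 / 2 : ℝ)))
        volume t₁ t₂ :=
      ((hrνi.const_mul _).add intervalIntegrable_const).add (hri.const_mul _)
    -- pointwise: `(CU + ν)² + s^{-1/2}(CU + ν) ≤ (ν² + s^{-1/2}ν) + (2CU s^{-1/2}ν + CU² + CU s^{-1/2})`
    -- (using `ν ≤ s^{-1/2} ν` since `s ≤ 1`)
    have hpt : ∀ s ∈ Icc t₁ t₂, (CU + ν s) ^ 2 + s ^ (-(1 / 2 : ℝ)) * (CU + ν s) ≤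
        (ν s ^ 2 + s ^ (-(1 / 2 : ℝ)) * ν s) +
          (2 * CU * (s ^ (-(1 / 2 : ℝ)) * ν s) + CU ^ 2 + CU * s ^ (-(1 / 2 : ℝ))) := by
      intro s hs
      have hs0 : 0 < s := ht₁.trans_le hs.1
      have hs1 : s ≤ 1 := (hs.2.trans h2T).trans hT1
      have hνs : 0 ≤ ν s := hν0 s (hsub hs)
      have hr1 : 1 ≤ s ^ (-(1 / 2 : ℝ)) := by
        rw [Real.rpow_neg hs0.le]
        exact one_le_inv_iff₀.2 ⟨Real.rpow_pos_of_pos hs0 _,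
          Real.rpow_le_one hs0.le hs1 (by norm_num)⟩
      have hνle : ν s ≤ s ^ (-(1 / 2 : ℝ)) * ν s := by
        calc ν s = 1 * ν s := (one_mul _).symm
          _ ≤ s ^ (-(1 / 2 : ℝ)) * ν s := mul_le_mul_of_nonneg_right hr1 hνs
      nlinarith
    have hmono : ∫ s in t₁..t₂, ((CU + ν s) ^ 2 + s ^ (-(1 / 2 : ℝ)) * (CU + ν s)) ≤
        ∫ s in t₁..t₂, ((ν s ^ 2 + s ^ (-(1 / 2 : ℝ)) * ν s) +
          (2 * CU * (s ^ (-(1 / 2 : ℝ)) * ν s) + CU ^ 2 + CU * s ^ (-(1 / 2 : ℝ)))) := by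
      refine integral_mono_on h12 ?_ (hAi.add hBi) hpt
      exact ((((continuousOn_const.add hνc).pow 2).mono hsub).intervalIntegrable_of_Icc h12).add
        (hri.mul_continuousOn ((continuousOn_const.add hνc).mono
          (by rw [uIcc_of_le h12]; exact hsub)))
    -- the four integrals
    have hA : ∫ s in t₁..t₂, (ν s ^ 2 + s ^ (-(1 / 2 : ℝ)) * ν s) ≤ C * (1 + η * L) :=
      h313b t₁ t₂ ht₁ h12 h2T
    have hrν : ∫ s in t₁..t₂, s ^ (-(1 / 2 : ℝ)) * ν s ≤ C * (1 + η * L) := by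
      have h1 : ∫ s in t₁..t₂, s ^ (-(1 / 2 : ℝ)) * ν s ≤
          ∫ s in t₁..t₂, (ν s ^ 2 + s ^ (-(1 / 2 : ℝ)) * ν s) :=
        integral_mono_on h12 hrνi hAi fun s _ => by nlinarith [sq_nonneg (ν s)]
      exact h1.trans hA
    have hconst : ∫ _ in t₁..t₂, CU ^ 2 = (t₂ - t₁) * CU ^ 2 := by
      rw [intervalIntegral.integral_const, smul_eq_mul]
    have hconst' : (t₂ - t₁) * CU ^ 2 ≤ CU ^ 2 := by
      have : t₂ - t₁ ≤ 1 := by linarith [h2T.trans hT1]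
      have : 0 ≤ CU ^ 2 := sq_nonneg _
      nlinarith
    have hr : ∫ s in t₁..t₂, s ^ (-(1 / 2 : ℝ)) = 2 * (Real.sqrt t₂ - Real.sqrt t₁) := by
      rw [integral_rpow (Or.inl (by norm_num))]
      have h1 : (-(1 / 2 : ℝ)) + 1 = 1 / 2 := by norm_num
      rw [h1, Real.sqrt_eq_rpow, Real.sqrt_eq_rpow]
      field_simp
    have hr' : 2 * (Real.sqrt t₂ - Real.sqrt t₁) ≤ 2 := by
      have h1 : Real.sqrt t₂ ≤ 1 := Real.sqrt_le_one.2 (h2T.trans hT1)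
      have h2 : 0 ≤ Real.sqrt t₁ := Real.sqrt_nonneg _
      linarith
    have hB : ∫ s in t₁..t₂, (2 * CU * (s ^ (-(1 / 2 : ℝ)) * ν s) + CU ^ 2 + CU * s ^ (-(1 / 2 : ℝ))) ≤
        2 * CU * (C * (1 + η * L)) + CU ^ 2 + CU * 2 := by
      rw [integral_add ((hrνi.const_mul _).add intervalIntegrable_const) (hri.const_mul _),
        integral_add (hrνi.const_mul _) intervalIntegrable_const,
        intervalIntegral.integral_const_mul, intervalIntegral.integral_const_mul, hconst, hr]
      have h1 : 2 * CU * ∫ s in t₁..t₂, s ^ (-(1 / 2 : ℝ)) * ν s ≤ 2 * CU * (C * (1 + η * L)) :=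
        mul_le_mul_of_nonneg_left hrν (by positivity)
      have h2 : CU * (2 * (Real.sqrt t₂ - Real.sqrt t₁)) ≤ CU * 2 := mul_le_mul_of_nonneg_left hr' hCU
      linarith
    rw [integral_add hAi hBi] at hmono
    have hηL : 0 ≤ η * L := mul_nonneg hη hL0
    calc ∫ s in t₁..t₂, ((CU + ν s) ^ 2 + s ^ (-(1 / 2 : ℝ)) * (CU + ν s))
        ≤ C * (1 + η * L) + (2 * CU * (C * (1 + η * L)) + CU ^ 2 + CU * 2) :=
          hmono.trans (add_le_add hA hB)
      _ = C * (1 + 2 * CU) * (1 + η * L) + (CU ^ 2 + 2 * CU) * 1 := by ring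
      _ ≤ C * (1 + 2 * CU) * (1 + η * L) + (CU ^ 2 + 2 * CU) * (1 + η * L) := by
          have h1 : 0 ≤ CU ^ 2 + 2 * CU := by positivity
          nlinarith
      _ = (C * (1 + 2 * CU) + CU ^ 2 + 2 * CU) * (1 + η * L) := by ring

/-- **Prop. 5.2 at the level of sup norms: the resolvent of the linearisation around
`U^{1/N₀} + v` is bounded on the profile `t^{a-1/2}`.** With `ν(s) = ‖v(s)‖_∞` obeying the
Koch–Tataru bound `√s ν ≤ K₀` and the lacunary bound with constant `C` and slope `η`
(Prop. 4.3, last display), `C_U ≥ 0` the sup norm of the background (§5), `T ≤ 1`, and the slope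
small in terms of the ENLARGED constants `K₀ + C_U`, `C_U' = C(1+2C_U) + C_U² + 2C_U`:
`Σₙ (Kⁿ_{C_U + ν} p_a)(t) ≤ C_R t^{a-1/2}` on `(0, T]` — the tree's
`LacunaryVolterra.tsum_iterate_volterraK_powProfile_le` for the majorant `C_U + ν`
(hypothesis `hR` of `CP25Picard.exists_perturbation_fixedPoint` for the CDP corrector).
[cite: CheskidovDaiPalasek2025, Prop. 5.2 and its proof] -/
theorem tsum_iterate_volterraK_powProfile_const_add_le {c : ℝ} (hc : 0 < c) (hK₀ : 0 < K₀)
    (hC : 0 ≤ C) (hη : 0 ≤ η) (hCU : 0 ≤ CU) (hT1 : T ≤ 1)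
    (hνm : Measurable ν) (hνc : ContinuousOn ν (Ioc 0 T)) (hν0 : ∀ s ∈ Ioc 0 T, 0 ≤ ν s)
    (h313a : ∀ s ∈ Ioc 0 T, Real.sqrt s * ν s ≤ K₀)
    (h313b : ∀ t₁ t₂ : ℝ, 0 < t₁ → t₁ ≤ t₂ → t₂ ≤ T →
      ∫ s in t₁..t₂, (ν s ^ 2 + s ^ (-(1 / 2 : ℝ)) * ν s) ≤ C * (1 + η * Real.log (t₂ / t₁)))
    {a : ℝ} (ha : 0 < a) (ha1 : a ≤ 1)
    (hε : ((3 * (c * (1 + 2731 * c ^ 2 * (K₀ + CU)) * (C * (1 + 2 * CU) + CU ^ 2 + 2 * CU)) + 1) *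
      η) ≤ a / 2)
    {t : ℝ} (ht : t ∈ Ioc 0 T) :
    ∑' n, (volterraK c (fun s => CU + ν s))^[n] (powProfile a) t ≤
      ENNReal.ofReal ((2 / a + 4 + 2 * (3 * (c * (10 * (K₀ + CU) +
        Real.sqrt 2 * (C * (1 + 2 * CU) + CU ^ 2 + 2 * CU))) *
        Real.exp (3 * (c * (1 + 2731 * c ^ 2 * (K₀ + CU)) * (C * (1 + 2 * CU) + CU ^ 2 + 2 * CU)))) / a) *
        t ^ (a - 1 / 2)) := by
  obtain ⟨hKT, hlog⟩ := volterraData_const_add hT1 hη hCU hνc hν0 h313a h313b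
  have hK₀' : 0 < K₀ + CU := by linarith
  have hC' : 0 ≤ C * (1 + 2 * CU) + CU ^ 2 + 2 * CU := by positivity
  exact tsum_iterate_volterraK_powProfile_le hc hK₀' hC' hη (measurable_const.add hνm)
    (continuousOn_const.add hνc) (fun s hs => add_nonneg hCU (hν0 s hs)) hKT hlog ha ha1 hε ht

/-- **The quadratic term as a power in the majorant.** If `ν ≥ 0` is continuous on `(0, T]`,
`T ≤ 1`, with `√s ν(s) ≤ K₀` (`K₀ ≥ 0`) and `∫_{t₁}^{t₂}(ν² + s^{-1/2}ν) ≤ C(1 + η log(t₂/t₁))`, then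
the augmented profile `ν̃ = ν + s^{α-1/2}` (`α > 0`; the a priori bound of the corrector in the
class `‖w(s)‖ ≤ s^{α-1/2}`) satisfies `√s ν̃ ≤ K₀ + 1` and
`∫_{t₁}^{t₂}(ν̃² + s^{-1/2}ν̃) ≤ (C + (2K₀+1)/α + 1/(2α))(1 + η log(t₂/t₁))` (the extra terms are
`≤ (2K₀+1)s^{α-1} + s^{2α-1}`). Dimension-free twin of the tree's
`CoiculescuPalasek2025.IsApproximateSolution.lacunary_supProfile_add_rpow`.
[cite: CheskidovDaiPalasek2025, proof of Prop. 5.3 (the ball B_X(0,δ))] -/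
theorem volterraData_add_rpow (hT1 : T ≤ 1) (hK₀ : 0 ≤ K₀) (hη : 0 ≤ η) {α : ℝ} (hα : 0 < α)
    (hνc : ContinuousOn ν (Ioc 0 T)) (hν0 : ∀ s ∈ Ioc 0 T, 0 ≤ ν s)
    (h313a : ∀ s ∈ Ioc 0 T, Real.sqrt s * ν s ≤ K₀)
    (h313b : ∀ t₁ t₂ : ℝ, 0 < t₁ → t₁ ≤ t₂ → t₂ ≤ T →
      ∫ s in t₁..t₂, (ν s ^ 2 + s ^ (-(1 / 2 : ℝ)) * ν s) ≤ C * (1 + η * Real.log (t₂ / t₁))) :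
    (∀ s ∈ Ioc 0 T, Real.sqrt s * (ν s + s ^ (α - 1 / 2)) ≤ K₀ + 1) ∧
    (∀ t₁ t₂ : ℝ, 0 < t₁ → t₁ ≤ t₂ → t₂ ≤ T →
      ∫ s in t₁..t₂, ((ν s + s ^ (α - 1 / 2)) ^ 2 + s ^ (-(1 / 2 : ℝ)) * (ν s + s ^ (α - 1 / 2))) ≤
        (C + (2 * K₀ + 1) / α + 1 / (2 * α)) * (1 + η * Real.log (t₂ / t₁))) := by
  refine ⟨fun s hs => ?_, fun t₁ t₂ ht₁ h12 ht₂ => ?_⟩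
  · have hs0 : 0 < s := hs.1
    have hs1 : s ≤ 1 := hs.2.trans hT1
    have e1 : Real.sqrt s * s ^ (α - 1 / 2) = s ^ α := by
      rw [Real.sqrt_eq_rpow, ← Real.rpow_add hs0]
      congr 1
      ring
    have h1 : s ^ α ≤ 1 := Real.rpow_le_one hs0.le hs1 hα.le
    calc Real.sqrt s * (ν s + s ^ (α - 1 / 2)) = Real.sqrt s * ν s + Real.sqrt s * s ^ (α - 1 / 2) := by
          ring
      _ ≤ K₀ + 1 := by rw [e1]; exact add_le_add (h313a s hs) h1
  · have hmem : ∀ s ∈ Icc t₁ t₂, s ∈ Ioc 0 T := fun s hs => ⟨ht₁.trans_le hs.1, hs.2.trans ht₂⟩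
    have hL : 0 ≤ Real.log (t₂ / t₁) := Real.log_nonneg ((one_le_div ht₁).2 h12)
    have hL1 : 1 ≤ 1 + η * Real.log (t₂ / t₁) := le_add_of_nonneg_right (mul_nonneg hη hL)
    -- continuity on `[t₁, t₂]`
    have hνc' : ContinuousOn ν (Icc t₁ t₂) := hνc.mono fun s hs => hmem s hs
    have hpc : ∀ e : ℝ, ContinuousOn (fun s : ℝ => s ^ e) (Icc t₁ t₂) := fun e =>
      continuousOn_id.rpow_const fun s hs => Or.inl (ht₁.trans_le hs.1).ne'
    have hii : ∀ {f : ℝ → ℝ}, ContinuousOn f (Icc t₁ t₂) → IntervalIntegrable f volume t₁ t₂ :=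
      fun hf => hf.intervalIntegrable_of_Icc h12
    -- the two majorants
    set g₁ : ℝ → ℝ := fun s => ν s ^ 2 + s ^ (-(1 / 2 : ℝ)) * ν s with hg₁
    set g₂ : ℝ → ℝ := fun s => (2 * K₀ + 1) * s ^ (α - 1) + s ^ (2 * α - 1) with hg₂
    have hg₁c : ContinuousOn g₁ (Icc t₁ t₂) := (hνc'.pow 2).add ((hpc _).mul hνc')
    have hg₂c : ContinuousOn g₂ (Icc t₁ t₂) := (continuousOn_const.mul (hpc _)).add (hpc _)
    have hfc : ContinuousOn (fun s => (ν s + s ^ (α - 1 / 2)) ^ 2 +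
        s ^ (-(1 / 2 : ℝ)) * (ν s + s ^ (α - 1 / 2))) (Icc t₁ t₂) :=
      ((hνc'.add (hpc _)).pow 2).add ((hpc _).mul (hνc'.add (hpc _)))
    -- pointwise comparison
    have hpt : ∀ s ∈ Icc t₁ t₂, (ν s + s ^ (α - 1 / 2)) ^ 2 +
        s ^ (-(1 / 2 : ℝ)) * (ν s + s ^ (α - 1 / 2)) ≤ g₁ s + g₂ s := by
      intro s hs
      have hs0 : 0 < s := ht₁.trans_le hs.1
      have hνs : ν s ≤ K₀ * s ^ (-(1 / 2 : ℝ)) := by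
        have h1 := h313a s (hmem s hs)
        rw [Real.rpow_neg hs0.le, ← Real.sqrt_eq_rpow]
        rw [← div_eq_mul_inv, le_div_iff₀ (Real.sqrt_pos.2 hs0)]
        linarith
      have hν0' : 0 ≤ ν s := hν0 s (hmem s hs)
      have hp0 : 0 ≤ s ^ (α - 1 / 2) := Real.rpow_nonneg hs0.le _
      have e1 : s ^ (-(1 / 2 : ℝ)) * s ^ (α - 1 / 2) = s ^ (α - 1) := by
        rw [← Real.rpow_add hs0]; congr 1; ring
      have e2 : s ^ (α - 1 / 2) * s ^ (α - 1 / 2) = s ^ (2 * α - 1) := by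
        rw [← Real.rpow_add hs0]; congr 1; ring
      have hcross : ν s * s ^ (α - 1 / 2) ≤ K₀ * s ^ (α - 1) := by
        calc ν s * s ^ (α - 1 / 2) ≤ K₀ * s ^ (-(1 / 2 : ℝ)) * s ^ (α - 1 / 2) :=
              mul_le_mul_of_nonneg_right hνs hp0
          _ = K₀ * s ^ (α - 1) := by rw [mul_assoc, e1]
      have hexp : (ν s + s ^ (α - 1 / 2)) ^ 2 + s ^ (-(1 / 2 : ℝ)) * (ν s + s ^ (α - 1 / 2)) =
          g₁ s + (2 * (ν s * s ^ (α - 1 / 2)) + s ^ (2 * α - 1) + s ^ (α - 1)) := by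
        simp only [hg₁]; rw [← e1, ← e2]; ring
      rw [hexp]
      refine add_le_add le_rfl ?_
      simp only [hg₂]
      nlinarith [hcross, Real.rpow_nonneg hs0.le (α - 1)]
    -- the integrals of the majorants
    have hI₁ : ∫ s in t₁..t₂, g₁ s ≤ C * (1 + η * Real.log (t₂ / t₁)) := h313b t₁ t₂ ht₁ h12 ht₂
    have hrpow : ∀ {e : ℝ}, 0 < e → ∫ s in t₁..t₂, s ^ (e - 1) ≤ 1 / e := by
      intro e he
      have h0 : (0 : ℝ) ∉ uIcc t₁ t₂ := by
        rw [uIcc_of_le h12]; exact fun h0 => (lt_irrefl (0 : ℝ)) (ht₁.trans_le h0.1)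
      rw [integral_rpow (Or.inr ⟨ne_of_gt (by linarith), h0⟩)]
      have e1 : e - 1 + 1 = e := by ring
      rw [e1]
      have h1 : t₂ ^ e ≤ 1 := Real.rpow_le_one (ht₁.le.trans h12) (ht₂.trans hT1) he.le
      have h2 : 0 ≤ t₁ ^ e := Real.rpow_nonneg ht₁.le _
      exact div_le_div_of_nonneg_right (by linarith) he.le
    have hI₂ : ∫ s in t₁..t₂, g₂ s ≤ (2 * K₀ + 1) / α + 1 / (2 * α) := by
      simp only [hg₂]
      have i1 : IntervalIntegrable (fun s : ℝ => (2 * K₀ + 1) * s ^ (α - 1)) volume t₁ t₂ :=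
        hii (continuousOn_const.mul (hpc _))
      have i2 : IntervalIntegrable (fun s : ℝ => s ^ (2 * α - 1)) volume t₁ t₂ := hii (hpc _)
      rw [intervalIntegral.integral_add i1 i2, intervalIntegral.integral_const_mul]
      have h2α : ∫ s in t₁..t₂, s ^ (2 * α - 1) ≤ 1 / (2 * α) := hrpow (by linarith)
      have hα' : ∫ s in t₁..t₂, s ^ (α - 1) ≤ 1 / α := hrpow hα
      have hK0 : 0 ≤ 2 * K₀ + 1 := by positivity
      calc (2 * K₀ + 1) * (∫ s in t₁..t₂, s ^ (α - 1)) + ∫ s in t₁..t₂, s ^ (2 * α - 1)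
          ≤ (2 * K₀ + 1) * (1 / α) + 1 / (2 * α) := add_le_add (mul_le_mul_of_nonneg_left hα' hK0) h2α
        _ = (2 * K₀ + 1) / α + 1 / (2 * α) := by ring
    -- assembling
    calc ∫ s in t₁..t₂, ((ν s + s ^ (α - 1 / 2)) ^ 2 + s ^ (-(1 / 2 : ℝ)) * (ν s + s ^ (α - 1 / 2)))
        ≤ ∫ s in t₁..t₂, (g₁ s + g₂ s) :=
          intervalIntegral.integral_mono_on h12 (hii hfc) (hii (hg₁c.add hg₂c)) hpt
      _ = (∫ s in t₁..t₂, g₁ s) + ∫ s in t₁..t₂, g₂ s :=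
          intervalIntegral.integral_add (hii hg₁c) (hii hg₂c)
      _ ≤ C * (1 + η * Real.log (t₂ / t₁)) + ((2 * K₀ + 1) / α + 1 / (2 * α)) := add_le_add hI₁ hI₂
      _ ≤ C * (1 + η * Real.log (t₂ / t₁)) +
            ((2 * K₀ + 1) / α + 1 / (2 * α)) * (1 + η * Real.log (t₂ / t₁)) := by
          have h0 : 0 ≤ (2 * K₀ + 1) / α + 1 / (2 * α) := by positivity
          nlinarith
      _ = (C + (2 * K₀ + 1) / α + 1 / (2 * α)) * (1 + η * Real.log (t₂ / t₁)) := by ring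

/-- **Prop. 5.2 for the corrector scheme: the resolvent of the majorant
`ν_w = (C_U + ν) + s^{a-1/2}` of the Picard iteration is bounded on `t^{a-1/2}`.** This is the
majorant appearing in hypothesis `hR` of `CP25Picard.exists_perturbation_fixedPoint` when the
background of the linearisation is `vt = ` lift of `U(· + T_*) + v` with `‖vt(t)‖ ≤ C_U + ν(t)`
(the extra `s^{a-1/2}` being the a priori bound of the corrector): data `√s ν ≤ K₀`,
`∫(ν² + s^{-1/2}ν) ≤ C(1 + η log)` for `ν(s) = ‖v(s)‖_∞` (Prop. 4.3, last display), `C_U ≥ 0`,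
`T ≤ 1`, `0 < a ≤ 1`, and slope small in terms of the constants `K̃ = K₀ + C_U + 1`,
`C̃ = C_U' + (2(K₀ + C_U) + 1)/a + 1/(2a)`, `C_U' = C(1+2C_U) + C_U² + 2C_U`.
[cite: CheskidovDaiPalasek2025, Props. 5.2–5.3 and their proofs] -/
theorem tsum_iterate_volterraK_powProfile_background_le {c : ℝ} (hc : 0 < c) (hK₀ : 0 ≤ K₀)
    (hη : 0 ≤ η) (hCU : 0 ≤ CU) (hT1 : T ≤ 1)
    (hνm : Measurable ν) (hνc : ContinuousOn ν (Ioc 0 T)) (hν0 : ∀ s ∈ Ioc 0 T, 0 ≤ ν s)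
    (h313a : ∀ s ∈ Ioc 0 T, Real.sqrt s * ν s ≤ K₀)
    (h313b : ∀ t₁ t₂ : ℝ, 0 < t₁ → t₁ ≤ t₂ → t₂ ≤ T →
      ∫ s in t₁..t₂, (ν s ^ 2 + s ^ (-(1 / 2 : ℝ)) * ν s) ≤ C * (1 + η * Real.log (t₂ / t₁)))
    {a : ℝ} (ha : 0 < a) (ha1 : a ≤ 1)
    (hε : ((3 * (c * (1 + 2731 * c ^ 2 * (K₀ + CU + 1)) *
      ((C * (1 + 2 * CU) + CU ^ 2 + 2 * CU) + (2 * (K₀ + CU) + 1) / a + 1 / (2 * a))) + 1) * η) ≤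
      a / 2)
    {t : ℝ} (ht : t ∈ Ioc 0 T) :
    ∑' n, (volterraK c (fun s => (CU + ν s) + s ^ (a - 1 / 2)))^[n] (powProfile a) t ≤
      ENNReal.ofReal ((2 / a + 4 + 2 * (3 * (c * (10 * (K₀ + CU + 1) +
        Real.sqrt 2 * ((C * (1 + 2 * CU) + CU ^ 2 + 2 * CU) + (2 * (K₀ + CU) + 1) / a + 1 / (2 * a)))) *
        Real.exp (3 * (c * (1 + 2731 * c ^ 2 * (K₀ + CU + 1)) *
          ((C * (1 + 2 * CU) + CU ^ 2 + 2 * CU) + (2 * (K₀ + CU) + 1) / a + 1 / (2 * a))))) / a) *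
        t ^ (a - 1 / 2)) := by
  -- the background as a constant
  obtain ⟨hKT, hlog⟩ := volterraData_const_add hT1 hη hCU hνc hν0 h313a h313b
  have hνc' : ContinuousOn (fun s => CU + ν s) (Ioc 0 T) := continuousOn_const.add hνc
  have hν0' : ∀ s ∈ Ioc 0 T, 0 ≤ CU + ν s := fun s hs => add_nonneg hCU (hν0 s hs)
  -- the quadratic term as a power
  obtain ⟨hKT', hlog'⟩ := volterraData_add_rpow (ν := fun s => CU + ν s) hT1 (by linarith) hη ha
    hνc' hν0' hKT hlog
  have hK' : 0 < K₀ + CU + 1 := by linarith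
  have hC' : 0 ≤ (C * (1 + 2 * CU) + CU ^ 2 + 2 * CU) + (2 * (K₀ + CU) + 1) / a + 1 / (2 * a) := by
    have h1 : 0 ≤ C := by
      -- `C ≥ 0`: the lacunary bound at `t₁ = t₂ = t` reads `0 ≤ C`
      have h := h313b t t ht.1 le_rfl ht.2
      rw [intervalIntegral.integral_same, div_self ht.1.ne', Real.log_one, mul_zero, add_zero,
        mul_one] at h
      exact h
    positivity
  have hpc : ContinuousOn (fun s : ℝ => s ^ (a - 1 / 2)) (Ioc 0 T) :=
    continuousOn_id.rpow_const fun s hs => Or.inl hs.1.ne'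
  exact tsum_iterate_volterraK_powProfile_le hc hK' hC' hη
    ((measurable_const.add hνm).add (measurable_id.pow_const _)) (hνc'.add hpc)
    (fun s hs => add_nonneg (hν0' s hs) (Real.rpow_nonneg hs.1.le _)) hKT' hlog' ha ha1 hε ht

end Literature.Barriers.NavierStokesRegularity
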